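import Literature.NumberTheory.Sieve.PrimesInAPGallagherRangeHolds
import HarnessLib

/-!
# Primes `p ≡ 1 (mod d)` in the Linnik–Gallagher range, with the SHAPE of the exceptional modulus

Topic `Literature/NumberTheory/Sieve`. THEOREMS only. Companion of `PrimesInAPGallagherRangeHolds.lean`.

The tree's `Literature.NumberTheory.Sieve.PrimesInAPGallagher.primesInAP_lowerBound` (Gallagher 1970, Theorem 7,
unconditional in the tree) gives, for `N ≥ N₀`, a modulus `b ≥ 2` such that
`#{p ≤ N : p ≡ 1 (mod d)} ≥ c N/(φ(d) log N)` for every `1 ≤ d ≤ N^δ` not divisible by `b`; but it hides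
behind `∃ b` what its proof knows about `b`: it is either larger than every modulus in range, or the
conductor `r̃` of a primitive character `χ̃ ≠ 1` having a REAL zero `β̃ ∈ [1 − c₃/log P, 1)`, `P = N^δ`
(an exceptional datum, `MontgomeryVaughan1975.IsExceptionalZero`).  Consumers that must avoid SPECIFIC moduli
(e.g. the 2-power moduli of `PrimesInAPTwoPowerModuli.lean`: Linnik-type prime supply `p ≡ 1 (mod 2^s)`,
`p ≤ 2^{As}`, where Page's theorem and the classification of quadratic characters of 2-power conductor
exclude `b ∣ 2^s`) need that shape.  This file re-runs the two deductions of the tree with the shape carried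
along:

* `sum_norm_gallagherTerm_le_nonexceptional_shape` — the per-modulus bound from the DH-free Gallagher theorem
  (`MontgomeryVaughan1975.gallagher_nonexceptional`), with `b = ⌊P⌋ + 1` or `b = r̃` for an exceptional datum
  `(r̃, χ̃, β̃)` at the level `c₃` of the saving `exp(−c₃ log N/log P)` (same constant);
* `primesInAP_lowerBound_of_sumBound_pred` — the deduction of the prime count from such a per-modulus bound,
  for an ARBITRARY predicate `Good N P b` threaded from hypothesis to conclusion (the tree's
  `primesInAP_lowerBound_of_sumBound` is the case `Good := ⊤`), with the internal level `P = N^δ` exposed;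
* `primesInAP_lowerBound_shape` — the assembled statement: `b > N^δ`, or `b` carries an exceptional datum at
  level `c₃` relative to `P = N^δ`.

## References

* P. X. Gallagher, Invent. Math. 11 (1970) 329–339, Theorem 7 [Gallagher1970].
* H. L. Montgomery, R. C. Vaughan, Acta Arith. 27 (1975) 353–370, §4 Lemma 4.3 [MontgomeryVaughanActa1975].
-/

noncomputable section

open Finset Real Filter

namespace Literature.NumberTheory.Sieve

namespace PrimesInAPGallagher

open MontgomeryVaughan1975

/-! ### The per-modulus bound with the shape of `b` -/

/-- **Per-modulus bound from the DH-free Gallagher theorem, with the shape of the exceptional modulus.**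
There are `c₃, c₄, K > 0` such that for `N ≥ 2`, `exp(log^{1/2} N) ≤ P ≤ N^{c₄}`, `P ≥ 1`, there is
`b ≥ 2` which is EITHER `> P` OR the modulus of an exceptional datum `(b, χ̃, β̃)` at level `c₃`
(`IsExceptionalZero c₃ P b χ̃ β̃`: `χ̃` primitive, `χ̃ ≠ 1`, `b ≤ P`, `L(β̃, χ̃) = 0`,
`1 − c₃/log P ≤ β̃ < 1`), with `∑_{χ mod d} ‖∑#_{p ≤ N} χ⋆(p) log p‖ ≤ (N + N/P) K exp(−c₃ log N/log P)` for
every `d ≤ P` not divisible by `b`.  Proof as for the tree's `sum_norm_gallagherTerm_le_nonexceptional`,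
recording the branch. [cite: Gallagher1970, Theorem 7] [cite: MontgomeryVaughanActa1975, §4 Lemma 4.3 (4.2)] -/
theorem sum_norm_gallagherTerm_le_nonexceptional_shape :
    ∃ c₃ : ℝ, 0 < c₃ ∧ ∃ c₄ : ℝ, 0 < c₄ ∧ ∃ K : ℝ, 0 < K ∧
      ∀ (N : ℕ) (P : ℝ), 2 ≤ N → Real.exp (Real.sqrt (Real.log N)) ≤ P → P ≤ (N : ℝ) ^ c₄ →
        1 ≤ P → ∃ b : ℕ, 2 ≤ b ∧
          (P < b ∨ ∃ (_ : NeZero b) (χe : DirichletCharacter ℂ b) (β : ℝ), IsExceptionalZero c₃ P b χe β) ∧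
          ∀ (d : ℕ) [NeZero d], (d : ℝ) ≤ P → ¬ b ∣ d →
            ∑ χ : DirichletCharacter ℂ d, ‖gallagherTerm χ.primitiveCharacter N N‖ ≤
              ((N : ℝ) + N / P) * K * Real.exp (-c₃ * Real.log N / Real.log P) := by
  classical
  obtain ⟨c₁, hc₁, c₄, hc₄, C, h⟩ := gallagher_nonexceptional
  refine ⟨c₁, hc₁, c₄, hc₄, max C 0 + 1, by positivity, ?_⟩
  intro N P hN hP1 hP2 hP3
  obtain ⟨hA, hB⟩ := h N P hN hP1 hP2 (fun _ _ => N) (fun _ _ => N) (fun _ _ => le_rfl)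
    (fun _ _ => le_rfl)
  set E : ℝ := Real.exp (-c₁ * Real.log N / Real.log P) with hE
  have hE0 : 0 < E := Real.exp_pos _
  have hN0 : (0 : ℝ) < N := by exact_mod_cast (show 0 < N by omega)
  have hNP : 0 < (N : ℝ) + N / P := by positivity
  have hC : C ≤ max C 0 + 1 := by have := le_max_left C 0; linarith
  by_cases hex : ∃ (r : ℕ) (_ : NeZero r) (χe : DirichletCharacter ℂ r) (β : ℝ),
      IsExceptionalZero c₁ P r χe β
  · -- the exceptional character occurs: `b = r̃`, and the family without `χ̃`
    obtain ⟨r, hr, χe, β, hexc⟩ := hex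
    have hB' := hB r χe β hexc
    have hr2 : 2 ≤ r := by
      obtain ⟨_, hne, -⟩ := hexc
      have hr0 : r ≠ 0 := NeZero.ne r
      have hr1 : r ≠ 1 := by
        rintro rfl; exact hne (DirichletCharacter.level_one χe)
      omega
    refine ⟨r, hr2, Or.inr ⟨hr, χe, β, hexc⟩, fun d _ hdP hrd => ?_⟩
    have hemb := sum_conductor_primitiveCharacter_le_filter hdP
      (fun q ψ => ((N : ℝ) + N / P)⁻¹ * ‖gallagherTerm ψ N N‖) (fun q ψ => by positivity)
      (fun q ψ => ψ.IsPrimitive ∧ ¬ (q = r ∧ ∀ n : ℕ, ψ (n : ZMod q) = χe (n : ZMod r)))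
      (fun q => inferInstance) (fun χ => ⟨χ.primitiveCharacter_isPrimitive, fun hh =>
        hrd (hh.1 ▸ χ.conductor_dvd_level)⟩)
    have hbound : ∑ χ : DirichletCharacter ℂ d,
        ((N : ℝ) + N / P)⁻¹ * ‖gallagherTerm χ.primitiveCharacter N N‖ ≤ C * E := by
      refine hemb.trans ?_
      convert hB' using 2
    have hsum : ∑ χ : DirichletCharacter ℂ d, ‖gallagherTerm χ.primitiveCharacter N N‖ =
        ((N : ℝ) + N / P) * ∑ χ : DirichletCharacter ℂ d,
          ((N : ℝ) + N / P)⁻¹ * ‖gallagherTerm χ.primitiveCharacter N N‖ := by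
      rw [Finset.mul_sum]
      refine Finset.sum_congr rfl fun χ _ => ?_
      rw [← mul_assoc, mul_inv_cancel₀ hNP.ne', one_mul]
    rw [hsum, mul_assoc]
    refine mul_le_mul_of_nonneg_left ?_ hNP.le
    calc _ ≤ C * E := hbound
      _ ≤ (max C 0 + 1) * E := mul_le_mul_of_nonneg_right hC hE0.le
  · -- no exceptional character: `b = ⌊P⌋ + 1 > P`
    push Not at hex
    have hA' := hA (fun r _ χ β hx => hex r inferInstance χ β hx)
    have hPb : P < (⌊P⌋₊ + 1 : ℕ) := by
      have := Nat.lt_floor_add_one P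
      exact_mod_cast this
    refine ⟨⌊P⌋₊ + 1, by have := Nat.le_floor (by exact_mod_cast hP3 : ((1 : ℕ) : ℝ) ≤ P); omega,
      Or.inl hPb, fun d _ hdP _ => ?_⟩
    have hemb := sum_conductor_primitiveCharacter_le_filter hdP
      (fun q ψ => ((N : ℝ) + N / P)⁻¹ * ‖gallagherTerm ψ N N‖) (fun q ψ => by positivity)
      (fun q ψ => ψ.IsPrimitive) (fun q => inferInstance) (fun χ => χ.primitiveCharacter_isPrimitive)
    have hbound : ∑ χ : DirichletCharacter ℂ d,
        ((N : ℝ) + N / P)⁻¹ * ‖gallagherTerm χ.primitiveCharacter N N‖ ≤ C * E := by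
      refine hemb.trans ?_
      convert hA' using 2
    have hsum : ∑ χ : DirichletCharacter ℂ d, ‖gallagherTerm χ.primitiveCharacter N N‖ =
        ((N : ℝ) + N / P) * ∑ χ : DirichletCharacter ℂ d,
          ((N : ℝ) + N / P)⁻¹ * ‖gallagherTerm χ.primitiveCharacter N N‖ := by
      rw [Finset.mul_sum]
      refine Finset.sum_congr rfl fun χ _ => ?_
      rw [← mul_assoc, mul_inv_cancel₀ hNP.ne', one_mul]
    rw [hsum, mul_assoc]
    refine mul_le_mul_of_nonneg_left ?_ hNP.le
    calc _ ≤ C * E := hbound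
      _ ≤ (max C 0 + 1) * E := mul_le_mul_of_nonneg_right hC hE0.le

/-! ### The deduction of the prime count, for an arbitrary predicate on `b` -/

/-- **Primes `p ≡ 1 (mod d)` in the Linnik–Gallagher range from a per-modulus bound, with a predicate on
the exceptional modulus carried along.**  If for `N ≥ 2`, `exp(log^{1/2} N) ≤ P ≤ N^{c₄}`, `P ≥ 1` there is
`b ≥ 2` satisfying `Good N P b` with `∑_{χ mod d} ‖∑#_{p ≤ N} χ⋆(p) log p‖ ≤ (N + N/P) K e^{−c₃ log N/log P}`
for all `d ≤ P`, `b ∤ d`, then there are `δ > 0` and `N₀` such that for `N ≥ N₀` there is `b ≥ 2` satisfying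
`Good N (N^δ) b` with `#{p ≤ N : p ≡ 1 (mod d)} ≥ (1/2) N/(φ(d) log N)` for all `1 ≤ d ≤ N^δ`, `b ∤ d`.
(`δ = min(c₄, 1/2, c₃/(16K))`, internal level `P = N^δ`; verbatim the tree's
`primesInAP_lowerBound_of_sumBound`.) [cite: Gallagher1970, Theorem 7 (the deduction of primes in progressions)] -/
theorem primesInAP_lowerBound_of_sumBound_pred (Good : ℕ → ℝ → ℕ → Prop)
    (hsum : ∃ c₃ : ℝ, 0 < c₃ ∧ ∃ c₄ : ℝ, 0 < c₄ ∧ ∃ K : ℝ, 0 < K ∧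
      ∀ (N : ℕ) (P : ℝ), 2 ≤ N → Real.exp (Real.sqrt (Real.log N)) ≤ P → P ≤ (N : ℝ) ^ c₄ →
        1 ≤ P → ∃ b : ℕ, 2 ≤ b ∧ Good N P b ∧ ∀ (d : ℕ) [NeZero d], (d : ℝ) ≤ P → ¬ b ∣ d →
          ∑ χ : DirichletCharacter ℂ d, ‖gallagherTerm χ.primitiveCharacter N N‖ ≤
            ((N : ℝ) + N / P) * K * Real.exp (-c₃ * Real.log N / Real.log P)) :
    ∃ δ : ℝ, 0 < δ ∧ ∃ N₀ : ℕ, ∀ N : ℕ, N₀ ≤ N → ∃ b : ℕ, 2 ≤ b ∧ Good N ((N : ℝ) ^ δ) b ∧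
      ∀ d : ℕ, 1 ≤ d → (d : ℝ) ≤ (N : ℝ) ^ δ → ¬ b ∣ d →
        (1 / 2 : ℝ) * N / (Nat.totient d * Real.log N) ≤
          (((Finset.Iic N).filter (fun p => p.Prime ∧ p ≡ 1 [MOD d])).card : ℝ) := by
  classical
  obtain ⟨c₃, hc₃, c₄, hc₄, K, hK, hE⟩ := hsum
  set δ : ℝ := min (min c₄ (1 / 2)) (c₃ / (16 * K)) with hδ
  have hδ0 : 0 < δ := lt_min (lt_min hc₄ (by norm_num)) (by positivity)
  have hδc₄ : δ ≤ c₄ := (min_le_left _ _).trans (min_le_left _ _)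
  have hδh : δ ≤ 1 / 2 := (min_le_left _ _).trans (min_le_right _ _)
  have hδK : δ ≤ c₃ / (16 * K) := min_le_right _ _
  refine ⟨δ, hδ0, ?_⟩
  -- eventual conditions on `N`
  have hlogN : Tendsto (fun N : ℕ => Real.log N) atTop atTop :=
    Real.tendsto_log_atTop.comp tendsto_natCast_atTop_atTop
  have hev : ∀ᶠ N : ℕ in atTop, 2 ≤ N ∧ 1 / δ ^ 2 ≤ Real.log N ∧
      Real.log N ≤ 1 / (4 * δ) * (N : ℝ) ^ (1 - δ) := by
    refine (eventually_ge_atTop 2).and ((hlogN.eventually (eventually_ge_atTop _)).and ?_)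
    have h1 : ∀ᶠ x : ℝ in atTop, ‖Real.log x‖ ≤ 1 / (4 * δ) * ‖x ^ (1 - δ)‖ :=
      (isLittleO_log_rpow_atTop (by linarith : 0 < 1 - δ)).def (by positivity)
    have h2 := tendsto_natCast_atTop_atTop.eventually (h1.and (eventually_ge_atTop (1 : ℝ)))
    filter_upwards [h2] with N hN
    obtain ⟨hN, hN1⟩ := hN
    rwa [Real.norm_of_nonneg (Real.log_nonneg hN1),
      Real.norm_of_nonneg (Real.rpow_nonneg (by linarith) _)] at hN
  obtain ⟨N₀, hN₀⟩ := eventually_atTop.mp hev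
  refine ⟨N₀, fun N hN => ?_⟩
  obtain ⟨hN2, hlog1, hlog2⟩ := hN₀ N hN
  have hN0 : (0 : ℝ) < N := by exact_mod_cast (show 0 < N by omega)
  have hN1 : (1 : ℝ) < N := by exact_mod_cast (show 1 < N by omega)
  have hL0 : 0 < Real.log N := Real.log_pos hN1
  set P : ℝ := (N : ℝ) ^ δ with hP
  have hP1 : 1 ≤ P := Real.one_le_rpow hN1.le hδ0.le
  have hPc₄ : P ≤ (N : ℝ) ^ c₄ := Real.rpow_le_rpow_of_exponent_le hN1.le hδc₄
  have hlogP : Real.log P = δ * Real.log N := Real.log_rpow hN0 δ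
  have hPexp : Real.exp (Real.sqrt (Real.log N)) ≤ P := by
    rw [hP, Real.rpow_def_of_pos hN0]
    refine Real.exp_le_exp.mpr ?_
    have hsq : Real.sqrt (Real.log N) * Real.sqrt (Real.log N) = Real.log N :=
      Real.mul_self_sqrt hL0.le
    have h1 : 1 ≤ δ * Real.sqrt (Real.log N) := by
      have h0 : 0 ≤ δ * Real.sqrt (Real.log N) := by positivity
      have h2 : 1 ≤ (δ * Real.sqrt (Real.log N)) ^ 2 := by
        rw [mul_pow, Real.sq_sqrt hL0.le]
        have := hlog1
        rw [div_le_iff₀ (by positivity)] at this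
        linarith
      nlinarith
    calc Real.sqrt (Real.log N) = Real.sqrt (Real.log N) * 1 := (mul_one _).symm
      _ ≤ Real.sqrt (Real.log N) * (δ * Real.sqrt (Real.log N)) :=
          mul_le_mul_of_nonneg_left h1 (Real.sqrt_nonneg _)
      _ = Real.log N * δ := by
          rw [show Real.sqrt (Real.log N) * (δ * Real.sqrt (Real.log N)) =
            δ * (Real.sqrt (Real.log N) * Real.sqrt (Real.log N)) by ring, hsq, mul_comm]
  obtain ⟨b, hb2, hgood, hbd⟩ := hE N P hN2 hPexp hPc₄ hP1
  refine ⟨b, hb2, hgood, fun d hd1 hdP hbd' => ?_⟩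
  haveI : NeZero d := ⟨by omega⟩
  -- the error term: `≤ (N + N/P) K e^{−c₃/δ} ≤ 2N K δ/c₃ ≤ N/8`
  have hexp : Real.exp (-c₃ * Real.log N / Real.log P) ≤ δ / c₃ := by
    rw [hlogP]
    have : -c₃ * Real.log N / (δ * Real.log N) = -(c₃ / δ) := by field_simp
    rw [this, Real.exp_neg]
    have ht : 0 < c₃ / δ := by positivity
    have h1 := Real.add_one_le_exp (c₃ / δ)
    rw [inv_le_comm₀ (Real.exp_pos _) (by positivity), inv_div]
    linarith
  have hEd : ∑ χ : DirichletCharacter ℂ d, ‖gallagherTerm χ.primitiveCharacter N N‖ ≤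
      (N : ℝ) / 8 := by
    refine (hbd d hdP hbd').trans ?_
    have h1 : (N : ℝ) + N / P ≤ 2 * N := by
      have : (N : ℝ) / P ≤ N := div_le_self hN0.le hP1
      linarith
    calc ((N : ℝ) + N / P) * K * Real.exp (-c₃ * Real.log N / Real.log P)
        ≤ (2 * N) * K * (δ / c₃) := by gcongr
      _ ≤ (2 * N) * K * (c₃ / (16 * K) / c₃) := by gcongr
      _ = N / 8 := by field_simp; ring
  -- `φ(d) log d ≤ d log d ≤ N^δ · δ log N ≤ N/4`
  have hdlog : (d.totient : ℝ) * Real.log d ≤ (N : ℝ) / 4 := by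
    have hφ : (d.totient : ℝ) ≤ d := by exact_mod_cast Nat.totient_le d
    have hd0 : (0 : ℝ) < d := by exact_mod_cast hd1
    have hlogd : Real.log d ≤ δ * Real.log N := by rw [← hlogP]; exact Real.log_le_log hd0 hdP
    have hlogd0 : 0 ≤ Real.log d := Real.log_nonneg (by exact_mod_cast hd1)
    calc (d.totient : ℝ) * Real.log d ≤ d * Real.log d := mul_le_mul_of_nonneg_right hφ hlogd0
      _ ≤ P * (δ * Real.log N) := mul_le_mul hdP hlogd hlogd0 (by positivity)
      _ ≤ P * (δ * (1 / (4 * δ) * (N : ℝ) ^ (1 - δ))) := by gcongr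
      _ = (N : ℝ) ^ δ * (N : ℝ) ^ (1 - δ) / 4 := by rw [hP]; field_simp
      _ = N / 4 := by rw [← Real.rpow_add hN0]; norm_num
  -- `θ(N; d, 1) ≥ N/(2 φ(d))`
  have hθ := totient_mul_theta_ge (d := d) N
  set θ₁ : ℝ := ∑ p ∈ ((Ioc 0 N).filter Nat.Prime).filter (fun p : ℕ => (p : ZMod d) = 1),
    Real.log p with hθ₁
  have hφ0 : (0 : ℝ) < d.totient := by exact_mod_cast Nat.totient_pos.mpr (by omega)
  have hθlow : (N : ℝ) / 2 ≤ d.totient * θ₁ := by linarith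
  -- `θ₁ ≤ #{p ≤ N : p ≡ 1 (d)} · log N`
  have hset : ((Ioc 0 N).filter Nat.Prime).filter (fun p : ℕ => (p : ZMod d) = 1) =
      (Finset.Iic N).filter (fun p => p.Prime ∧ p ≡ 1 [MOD d]) := by
    ext p
    simp only [Finset.mem_filter, Finset.mem_Ioc, Finset.mem_Iic]
    constructor
    · rintro ⟨⟨⟨-, hpN⟩, hpp⟩, hp1⟩
      refine ⟨hpN, hpp, ?_⟩
      have := (ZMod.natCast_eq_natCast_iff p 1 d).mp (by rw [hp1, Nat.cast_one])
      exact this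
    · rintro ⟨hpN, hpp, hp1⟩
      refine ⟨⟨⟨hpp.pos, hpN⟩, hpp⟩, ?_⟩
      have := (ZMod.natCast_eq_natCast_iff p 1 d).mpr hp1
      rwa [Nat.cast_one] at this
  have hθup : θ₁ ≤ (((Finset.Iic N).filter (fun p => p.Prime ∧ p ≡ 1 [MOD d])).card : ℝ) *
      Real.log N := by
    rw [hθ₁, hset]
    have := Finset.sum_le_card_nsmul ((Finset.Iic N).filter (fun p => p.Prime ∧ p ≡ 1 [MOD d]))
      (fun p => Real.log p) (Real.log N) (fun p hp => ?_)
    · rwa [nsmul_eq_mul] at this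
    · obtain ⟨hpN, hpp, -⟩ := by simpa [Finset.mem_filter] using hp
      exact Real.log_le_log (by exact_mod_cast hpp.pos) (by exact_mod_cast hpN)
  -- conclude
  rw [div_le_iff₀ (by positivity)]
  have := mul_le_mul_of_nonneg_left hθup hφ0.le
  nlinarith

/-! ### Assembly -/

/-- **Primes `p ≡ 1 (mod d)` for all `d ≤ N^δ` off one exceptional modulus, with the shape of that
modulus — UNCONDITIONAL.**  There are `c₃, δ > 0` and `N₀` such that for every `N ≥ N₀` there is `b ≥ 2`,
EITHER `b > N^δ` OR the modulus of an exceptional datum `(b, χ̃, β̃)` at level `c₃` relative to `P = N^δ`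
(`χ̃` primitive non-principal mod `b ≤ N^δ` with `L(β̃, χ̃) = 0`, `1 − c₃/(δ log N) ≤ β̃ < 1`), such that
`#{p ≤ N prime : p ≡ 1 (mod d)} ≥ (1/2) N/(φ(d) log N)` for all `1 ≤ d ≤ N^δ` with `b ∤ d`.  The tree's
`primesInAP_lowerBound` is this statement with the shape forgotten. [cite: Gallagher1970, Theorem 7] -/
theorem primesInAP_lowerBound_shape :
    ∃ c₃ : ℝ, 0 < c₃ ∧ ∃ δ : ℝ, 0 < δ ∧ ∃ N₀ : ℕ, ∀ N : ℕ, N₀ ≤ N → ∃ b : ℕ, 2 ≤ b ∧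
      ((N : ℝ) ^ δ < b ∨
        ∃ (_ : NeZero b) (χe : DirichletCharacter ℂ b) (β : ℝ), IsExceptionalZero c₃ ((N : ℝ) ^ δ) b χe β) ∧
      ∀ d : ℕ, 1 ≤ d → (d : ℝ) ≤ (N : ℝ) ^ δ → ¬ b ∣ d →
        (1 / 2 : ℝ) * N / (Nat.totient d * Real.log N) ≤
          (((Finset.Iic N).filter (fun p => p.Prime ∧ p ≡ 1 [MOD d])).card : ℝ) := by
  obtain ⟨c₃, hc₃, c₄, hc₄, K, hK, h⟩ := sum_norm_gallagherTerm_le_nonexceptional_shape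
  obtain ⟨δ, hδ, N₀, hN₀⟩ := primesInAP_lowerBound_of_sumBound_pred
    (fun _ P b => P < b ∨ ∃ (_ : NeZero b) (χe : DirichletCharacter ℂ b) (β : ℝ),
      IsExceptionalZero c₃ P b χe β)
    ⟨c₃, hc₃, c₄, hc₄, K, hK, h⟩
  exact ⟨c₃, hc₃, δ, hδ, N₀, hN₀⟩

end PrimesInAPGallagher

end Literature.NumberTheory.Sieve
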